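import Literature.MathematicalPhysics.QuantumFieldTheory.Balaban1983to89.Node00.BetaOfRecord

/-!
# CRIT-1 CUT-1 kernel for lens-2 «flow-gronwall-ttel» (candidate v0, 2026-08-30T16:52Z) — the Grönwall glue survives RESTRICTION OF ITS
# HYPOTHESES TO BOX HISTORIES (the repair CRIT-1 asks for), reproved; nothing else is claimed

Cell `ym-nodeO-ideate`, CRITIC seat `ym-nodeO-crit-1` (refuter-ym-nodeO-crit-1-g31-0; count-neutral; crux WORKFILE on `stmt-QuantumFields-20541`, not a gate filing).
FINDING (located, hypothesis-shape): lens-2's `StepContraction ∕ BaseBound ∕ ReadoutBound` (`nodeO-cover/LENS-2-Sketch-v0.lean` :88 ∕ :93 ∕ :97) quantify over ALL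
histories `v : Fin (k+2) → ℝ` — arbitrarily large or negative couplings included — although the glue `betaBox_of_flow` (:209) only ever invokes them at
histories INSIDE the box (its induction passes `Fin.init v ∈ Box γ k`).  For the record's size functional `e` (piece P-α⁺) and one-step remainder (P-β) the
unrestricted sentences are not what print offers (perturbative one-step estimates live on the small-field box) — so as an INTERFACE for P-β they are
misstated-strong.  REPAIR (free): the `…On γ̄` versions below; the glue is reproved VERBATIM-modulo-`hv` with the same constants.  Hypothesis shapes only;
nothing of Bałaban asserted; K0⁷ NOT closed; the Yang–Mills mass gap (Clay) is NOT proved by any of this.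
-/

noncomputable section

open Literature.MathematicalPhysics.QuantumFieldTheory.Balaban1983to89
open Literature.MathematicalPhysics.QuantumFieldTheory.Balaban1983to89.FlowStep
open Literature.MathematicalPhysics.QuantumFieldTheory.Balaban1983to89.Node00

namespace Summit.QuantumFields.YangMills.Cruxes.Record13SepCoPHInhabited.Crit1Cut1Lens2

/-- lens-2's history-indexed size functional (VERBATIM `HSize`). -/
abbrev HSize : Type := (k : ℕ) → (Fin (k + 1) → ℝ) → ℝ

/-- **One-scale contraction ON THE BOX `γ̄`** — lens-2's `StepContraction` with the history restricted to `Box γ̄ (k+1)`. [folklore] -/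
def StepContractionOn (γbar : ℝ) (e : HSize) (θ b₁ Λ : ℝ) : Prop :=
  ∀ (k : ℕ) (v : Fin (k + 2) → ℝ), v ∈ Box γbar (k + 1) →
    e (k + 1) v ≤ θ * e k (Fin.init v) + v (Fin.last (k + 1)) * (b₁ + Λ * e k (Fin.init v))

/-- **Base ON THE BOX.** [folklore] -/
def BaseBoundOn (γbar : ℝ) (e : HSize) (b₁ : ℝ) : Prop := ∀ v : Fin 1 → ℝ, v ∈ Box γbar 0 → e 0 v ≤ v 0 * b₁

/-- **Readout ON THE BOX.** [folklore] -/
def ReadoutBoundOn (γbar : ℝ) (βm : HBeta) (b : ℕ → ℝ) (e : HSize) (A a₀ a₁ : ℝ) : Prop :=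
  (∀ v : Fin 1 → ℝ, v ∈ Box γbar 0 → |βm 0 v - b 0| ≤ v 0 * a₀) ∧
    ∀ (k : ℕ) (v : Fin (k + 2) → ℝ), v ∈ Box γbar (k + 1) →
      |βm (k + 1) v - b (k + 1)| ≤ A * e k (Fin.init v) + v (Fin.last (k + 1)) * (a₀ + a₁ * e k (Fin.init v))

/-- CAP (VERBATIM). -/
def Cap (b : ℕ → ℝ) (B : ℝ) : Prop := ∀ k, |b k| ≤ B

/-- The unrestricted lens-2 sentences (VERBATIM shapes), to state that they imply the `On` versions. -/
def StepContraction (e : HSize) (θ b₁ Λ : ℝ) : Prop :=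
  ∀ (k : ℕ) (v : Fin (k + 2) → ℝ), e (k + 1) v ≤ θ * e k (Fin.init v) + v (Fin.last (k + 1)) * (b₁ + Λ * e k (Fin.init v))

/-- The unrestricted sentence implies the restricted one (so the repair costs the lens nothing it had). [folklore] -/
theorem stepContractionOn_of_stepContraction {e : HSize} {θ b₁ Λ : ℝ} (γbar : ℝ) (h : StepContraction e θ b₁ Λ) :
    StepContractionOn γbar e θ b₁ Λ := fun k v _ => h k v

theorem mem_box_iff {γ : ℝ} {k : ℕ} {v : Fin (k + 1) → ℝ} : v ∈ Box γ k ↔ ∀ i, 0 < v i ∧ v i ≤ γ := by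
  simp [Box, Set.mem_Ioc]

theorem init_mem_box {γ : ℝ} {k : ℕ} {v : Fin (k + 2) → ℝ} (h : v ∈ Box γ (k + 1)) : Fin.init v ∈ Box γ k := by
  rw [mem_box_iff] at h ⊢
  intro i
  exact h (Fin.castSucc i)

theorem box_mono {γ γ' : ℝ} (hγ : γ ≤ γ') {k : ℕ} {v : Fin (k + 1) → ℝ} (h : v ∈ Box γ k) : v ∈ Box γ' k := by
  rw [mem_box_iff] at h ⊢
  exact fun i => ⟨(h i).1, (h i).2.trans hγ⟩

/-- Grönwall level (VERBATIM). -/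
def gronwallM (θ b₁ Λ γ : ℝ) : ℝ := γ * b₁ / (1 - θ - γ * Λ)

theorem gronwallM_nonneg {θ b₁ Λ γ : ℝ} (hθ : 0 ≤ θ) (hb : 0 ≤ b₁) (hγ : 0 ≤ γ) (hgap : θ + γ * Λ < 1) : 0 ≤ gronwallM θ b₁ Λ γ := by
  unfold gronwallM
  exact div_nonneg (mul_nonneg hγ hb) (by linarith)

theorem gronwallM_eq {θ b₁ Λ γ : ℝ} (hgap : θ + γ * Λ < 1) :
    θ * gronwallM θ b₁ Λ γ + γ * (b₁ + Λ * gronwallM θ b₁ Λ γ) = gronwallM θ b₁ Λ γ := by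
  unfold gronwallM
  have h : (1 - θ - γ * Λ) ≠ 0 := by intro h0; linarith
  field_simp
  ring

/-- **DISCRETE GRÖNWALL OVER SCALES FROM THE BOX-RESTRICTED HYPOTHESES** (`γ ≤ γ̄`): same constant `M = γ b₁/(1 − θ − γΛ)`. [folklore] -/
theorem size_le_of_stepContractionOn {e : HSize} {θ b₁ Λ γ γbar : ℝ} (hθ : 0 ≤ θ) (hb : 0 ≤ b₁) (hΛ : 0 ≤ Λ) (hγ : 0 ≤ γ) (hγbar : γ ≤ γbar)
    (hgap : θ + γ * Λ < 1) (hstep : StepContractionOn γbar e θ b₁ Λ) (hbase : BaseBoundOn γbar e b₁) :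
    ∀ (k : ℕ) (v : Fin (k + 1) → ℝ), v ∈ Box γ k → e k v ≤ gronwallM θ b₁ Λ γ := by
  have hM := gronwallM_nonneg (b₁ := b₁) hθ hb hγ hgap
  intro k
  induction k with
  | zero =>
    intro v hv
    have h0 := (mem_box_iff.mp hv) 0
    calc e 0 v ≤ v 0 * b₁ := hbase v (box_mono hγbar hv)
      _ ≤ γ * b₁ := mul_le_mul_of_nonneg_right h0.2 hb
      _ = θ * 0 + γ * (b₁ + Λ * 0) := by ring
      _ ≤ θ * gronwallM θ b₁ Λ γ + γ * (b₁ + Λ * gronwallM θ b₁ Λ γ) := by gcongr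
      _ = gronwallM θ b₁ Λ γ := gronwallM_eq hgap
  | succ k ih =>
    intro v hv
    have hlast := (mem_box_iff.mp hv) (Fin.last (k + 1))
    have hinit : e k (Fin.init v) ≤ gronwallM θ b₁ Λ γ := ih (Fin.init v) (init_mem_box hv)
    have hsrc : b₁ + Λ * e k (Fin.init v) ≤ b₁ + Λ * gronwallM θ b₁ Λ γ := by gcongr
    have hsrc0 : 0 ≤ b₁ + Λ * gronwallM θ b₁ Λ γ := by positivity
    calc e (k + 1) v ≤ θ * e k (Fin.init v) + v (Fin.last (k + 1)) * (b₁ + Λ * e k (Fin.init v)) := hstep k v (box_mono hγbar hv)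
      _ ≤ θ * gronwallM θ b₁ Λ γ + γ * (b₁ + Λ * gronwallM θ b₁ Λ γ) := by
          have h1 : θ * e k (Fin.init v) ≤ θ * gronwallM θ b₁ Λ γ := mul_le_mul_of_nonneg_left hinit hθ
          have h2 : v (Fin.last (k + 1)) * (b₁ + Λ * e k (Fin.init v)) ≤ γ * (b₁ + Λ * gronwallM θ b₁ Λ γ) :=
            calc v (Fin.last (k + 1)) * (b₁ + Λ * e k (Fin.init v))
                ≤ v (Fin.last (k + 1)) * (b₁ + Λ * gronwallM θ b₁ Λ γ) := mul_le_mul_of_nonneg_left hsrc hlast.1.le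
              _ ≤ γ * (b₁ + Λ * gronwallM θ b₁ Λ γ) := mul_le_mul_of_nonneg_right hlast.2 hsrc0
          linarith
      _ = gronwallM θ b₁ Λ γ := gronwallM_eq hgap

/-- Box radius (VERBATIM). -/
def betaPrime (B A a₀ a₁ M γ : ℝ) : ℝ := B + A * M + γ * (a₀ + a₁ * M)

/-- **|β| ON THE BOX from the box-restricted hypotheses.** [folklore] -/
theorem abs_le_of_flowOn {βm : HBeta} {b : ℕ → ℝ} {e : HSize} {θ b₁ Λ γ γbar A a₀ a₁ B : ℝ}
    (hθ : 0 ≤ θ) (hb : 0 ≤ b₁) (hΛ : 0 ≤ Λ) (hγ : 0 ≤ γ) (hγbar : γ ≤ γbar) (hgap : θ + γ * Λ < 1) (hA : 0 ≤ A) (ha₀ : 0 ≤ a₀) (ha₁ : 0 ≤ a₁)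
    (hstep : StepContractionOn γbar e θ b₁ Λ) (hbase : BaseBoundOn γbar e b₁) (hread : ReadoutBoundOn γbar βm b e A a₀ a₁) (hcap : Cap b B) :
    ∀ (k : ℕ) (v : Fin (k + 1) → ℝ), v ∈ Box γ k → |βm k v| ≤ betaPrime B A a₀ a₁ (gronwallM θ b₁ Λ γ) γ := by
  have hM := gronwallM_nonneg (b₁ := b₁) hθ hb hγ hgap
  set M := gronwallM θ b₁ Λ γ with hMdef
  have hsize := size_le_of_stepContractionOn hθ hb hΛ hγ hγbar hgap hstep hbase
  intro k v hv
  cases k with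
  | zero =>
    have h0 := (mem_box_iff.mp hv) 0
    have hr : |βm 0 v - b 0| ≤ v 0 * a₀ := hread.1 v (box_mono hγbar hv)
    have hr' : v 0 * a₀ ≤ γ * a₀ := mul_le_mul_of_nonneg_right h0.2 ha₀
    have hc := hcap 0
    have hAM : 0 ≤ A * M := mul_nonneg hA hM
    have hγaM : 0 ≤ γ * (a₁ * M) := mul_nonneg hγ (mul_nonneg ha₁ hM)
    have htri : |βm 0 v| ≤ |βm 0 v - b 0| + |b 0| := by
      have := abs_add_le (βm 0 v - b 0) (b 0); simpa using this
    unfold betaPrime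
    nlinarith
  | succ k =>
    have hlast := (mem_box_iff.mp hv) (Fin.last (k + 1))
    have he : e k (Fin.init v) ≤ M := hsize k (Fin.init v) (init_mem_box hv)
    have hr := hread.2 k v (box_mono hγbar hv)
    have hc := hcap (k + 1)
    have h1 : A * e k (Fin.init v) ≤ A * M := mul_le_mul_of_nonneg_left he hA
    have hsrc : a₀ + a₁ * e k (Fin.init v) ≤ a₀ + a₁ * M := by gcongr
    have hsrc0 : 0 ≤ a₀ + a₁ * M := by positivity
    have h2 : v (Fin.last (k + 1)) * (a₀ + a₁ * e k (Fin.init v)) ≤ γ * (a₀ + a₁ * M) :=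
      calc v (Fin.last (k + 1)) * (a₀ + a₁ * e k (Fin.init v))
          ≤ v (Fin.last (k + 1)) * (a₀ + a₁ * M) := mul_le_mul_of_nonneg_left hsrc hlast.1.le
        _ ≤ γ * (a₀ + a₁ * M) := mul_le_mul_of_nonneg_right hlast.2 hsrc0
    have htri : |βm (k + 1) v| ≤ |βm (k + 1) v - b (k + 1)| + |b (k + 1)| := by
      have := abs_add_le (βm (k + 1) v - b (k + 1)) (b (k + 1)); simpa using this
    unfold betaPrime
    linarith

/-- **★ THE K0 SHAPE FROM THE BOX-RESTRICTED HYPOTHESES** — lens-2's `betaBox_of_flow` with `StepContractionOn ∕ BaseBoundOn ∕ ReadoutBoundOn γ̄` in place of the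
unrestricted sentences: the same `β' = B + A·M + γ(a₀ + a₁M)`, the same `γ ≤ γ̄`.  This is the glue CRIT-1 prices (the repair is free). [folklore] -/
theorem betaBox_of_flowOn {βm : HBeta} {β0 b : ℕ → ℝ} {e : HSize} {θ b₁ Λ γ γbar A a₀ a₁ B : ℝ}
    (hθ : 0 ≤ θ) (hb : 0 ≤ b₁) (hΛ : 0 ≤ Λ) (hγ : 0 ≤ γ) (hγbar : γ ≤ γbar) (hgap : θ + γ * Λ < 1)
    (hA : 0 ≤ A) (ha₀ : 0 ≤ a₀) (ha₁ : 0 ≤ a₁)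
    (hstep : StepContractionOn γbar e θ b₁ Λ) (hbase : BaseBoundOn γbar e b₁) (hread : ReadoutBoundOn γbar βm b e A a₀ a₁) (hcap : Cap b B) :
    BetaUpperH (betaPrime B A a₀ a₁ (gronwallM θ b₁ Λ γ) γ) γ (betaOfMerged βm β0 γbar) ∧
      BetaLowerH (-betaPrime B A a₀ a₁ (gronwallM θ b₁ Λ γ) γ) γ (betaOfMerged βm β0 γbar) := by
  have habs := abs_le_of_flowOn hθ hb hΛ hγ hγbar hgap hA ha₀ ha₁ hstep hbase hread hcap
  constructor
  · intro k v hv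
    rw [betaOfMerged_of_mem βm β0 γbar (box_mono hγbar hv)]
    exact (abs_le.mp (habs k v hv)).2
  · intro k v hv
    rw [betaOfMerged_of_mem βm β0 γbar (box_mono hγbar hv)]
    exact (abs_le.mp (habs k v hv)).1

end Summit.QuantumFields.YangMills.Cruxes.Record13SepCoPHInhabited.Crit1Cut1Lens2

end
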